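import Summits.HodgeConjecture.HodgeConjecture.Theorems.CyclicUnitaryPowersBlockExtension

/-!
# An eigen-adapted basis of `W` with `B`-dual blocks (for the GL first fundamental theorem of crux K2-A)

Helper for stub L `stub_deckUnitaryInvariantsMatching` of the crux `PowersHodgeOfDeckCommutators`
(stmt-HodgeConjecture-19545, route `CyclicUnitaryPowers`, line `unitary-kunneth-fft` v6, lane 2).  Over a field `K` of
characteristic zero with a primitive `p`-th root `ζ`, `p = 2h + 1`, for `σ` with `σ ^ p = 1` and a `σ`-invariant
nondegenerate form `B` (eigenblocks `E_j = range P_j` of `CyclicUnitaryPowersEigenPairing`), assuming the blocks `E_j`,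
`1 ≤ j < p`, have a common dimension `n` and `E_0 = K x₀` is a line:

* §1 the blocks indexed by `Option (Fin h × Bool)`: `none ↦ E_0`, `(i, false) ↦ E_{i+1}`, `(i, true) ↦ E_{p-(i+1)}`;
  they form an internal direct sum decomposition of `W` (`isInternal_block`);
* §2 bases: `x₀` of `E_0`, any basis `bE i` of `E_{i+1}` and the basis `bD i` of `E_{p-(i+1)}` DUAL to `bE i` under `B`
  (through the perfect pairing `eigenPairingEquiv`): `B (bE i a) (bD i a') = δ_{a a'}`;
* §3 **the adapted basis** `adaptedBasis : Basis (Option (Fin h × Bool × Fin n)) K W` collecting them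
  (`none ↦ x₀`, `(i, false, a) ↦ bE i a`, `(i, true, a) ↦ bD i a`), with its block memberships and the table of `B`
  on basis vectors (`B`-orthogonality of non-complementary blocks).

Pure linear algebra; no Hodge theory.
-/

noncomputable section

open Module
open scoped BigOperators

namespace Summit.HodgeConjecture.HodgeConjecture.Theorems.CyclicUnitaryPowersEigenDualBasis

open Summit.HodgeConjecture.HodgeConjecture.Theorems.CyclicUnitaryPowersSpectralProjectors
open Summit.HodgeConjecture.HodgeConjecture.Theorems.CyclicUnitaryPowersEigenPairing
open Summit.HodgeConjecture.HodgeConjecture.Theorems.CyclicUnitaryPowersBlockExtension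

variable {K : Type*} [Field K] [CharZero K] {W : Type*} [AddCommGroup W] [Module K W]
variable {σ : W →ₗ[K] W} {ζ : K} {p h : ℕ} {B : LinearMap.BilinForm K W}

/-! ### §1 The blocks -/

/-- The block index of a block label: `none ↦ 0`, `(i, false) ↦ i + 1`, `(i, true) ↦ p - (i + 1)`. [folklore] -/
def blockIdx (p h : ℕ) : Option (Fin h × Bool) → ℕ
  | none => 0
  | some (i, false) => i.val + 1
  | some (i, true) => p - (i.val + 1)

/-- The block of `none` is `E_0`. [folklore] -/
@[simp] theorem blockIdx_none : blockIdx p h none = 0 := rfl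
/-- The block of `(i, false)` is `E_{i+1}`. [folklore] -/
@[simp] theorem blockIdx_vec (i : Fin h) : blockIdx p h (some (i, false)) = i.val + 1 := rfl
/-- The block of `(i, true)` is `E_{p-(i+1)}`. [folklore] -/
@[simp] theorem blockIdx_cov (i : Fin h) : blockIdx p h (some (i, true)) = p - (i.val + 1) := rfl

/-- Block indices are `< p` (`p = 2h + 1`). [folklore] -/
theorem blockIdx_lt (hph : p = 2 * h + 1) (o : Option (Fin h × Bool)) : blockIdx p h o < p := by
  rcases o with _ | ⟨i, _ | _⟩
  · simp only [blockIdx_none]; omega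
  · simp only [blockIdx_vec]; omega
  · simp only [blockIdx_cov]; omega

/-- The block index is injective (`p = 2h + 1`). [folklore] -/
theorem blockIdx_injective (hph : p = 2 * h + 1) : Function.Injective (blockIdx p h) := by
  rintro (_ | ⟨i, _ | _⟩) (_ | ⟨i', _ | _⟩) hij <;>
    simp only [blockIdx_none, blockIdx_vec, blockIdx_cov] at hij
  · rfl
  · omega
  · have := i'.2; omega
  · omega
  · have : i = i' := Fin.ext (by omega)
    rw [this]
  · have := i.2; have := i'.2; omega
  · have := i.2; omega
  · have := i.2; have := i'.2; omega
  · have : i = i' := Fin.ext (by have := i.2; have := i'.2; omega)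
    rw [this]

/-- Every `j < p` is a block index (`p = 2h + 1`). [folklore] -/
theorem exists_blockIdx_eq (hph : p = 2 * h + 1) {j : ℕ} (hj : j < p) : ∃ o, blockIdx p h o = j := by
  by_cases h0 : j = 0
  · exact ⟨none, h0 ▸ rfl⟩
  by_cases hjh : j ≤ h
  · exact ⟨some (⟨j - 1, by omega⟩, false), by simp only [blockIdx_vec]; omega⟩
  · exact ⟨some (⟨p - j - 1, by omega⟩, true), by simp only [blockIdx_cov]; omega⟩

/-- **The blocks `E_{blockIdx o}` form an internal direct sum decomposition of `W`.** [folklore] -/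
theorem isInternal_block (hσ : σ ^ p = 1) (hζ : IsPrimitiveRoot ζ p) (hp : 0 < p) (hph : p = 2 * h + 1) :
    DirectSum.IsInternal fun o : Option (Fin h × Bool) => E σ ζ p (blockIdx p h o) := by
  classical
  apply DirectSum.isInternal_submodule_of_iSupIndep_of_iSup_eq_top
  · have hfam : (fun o : Option (Fin h × Bool) => E σ ζ p (blockIdx p h o)) =
        (fun μ : K => Module.End.eigenspace σ μ) ∘ fun o => ζ ^ blockIdx p h o :=
      funext fun o => range_specProj hσ hζ hp _
    rw [hfam]
    refine (Module.End.eigenspaces_iSupIndep σ).comp fun o o' hoo' => ?_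
    exact blockIdx_injective hph (hζ.pow_inj (blockIdx_lt hph o) (blockIdx_lt hph o') hoo')
  · refine eq_top_iff.mpr fun x _ => ?_
    rw [← sum_specProj_apply (σ := σ) hζ hp x]
    refine Submodule.sum_mem _ fun j hj => ?_
    obtain ⟨o, ho⟩ := exists_blockIdx_eq hph (Finset.mem_range.mp hj)
    have hmem : specProj σ ζ p j x ∈ E σ ζ p (blockIdx p h o) := by rw [ho]; exact LinearMap.mem_range_self _ _
    exact (le_iSup (fun o : Option (Fin h × Bool) => E σ ζ p (blockIdx p h o)) o) hmem

/-! ### §2 Bases of the blocks -/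

section Bases

variable [FiniteDimensional K W] (hσ : σ ^ p = 1) (hζ : IsPrimitiveRoot ζ p) (hp : 0 < p) (hph : p = 2 * h + 1)
  (hB : ∀ x y, B (σ x) (σ y) = B x y) (hBn : B.Nondegenerate)

omit [CharZero K] [FiniteDimensional K W] in
/-- `E_0 = K x₀` has dimension `1`. [folklore] -/
theorem finrank_E_zero {x₀ : W} (hx₀ : x₀ ≠ 0) (hx₀E : x₀ ∈ E σ ζ p 0)
    (hgen : ∀ x ∈ E σ ζ p 0, ∃ c : K, x = c • x₀) : Module.finrank K ↥(E σ ζ p 0) = 1 := by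
  have hE : E σ ζ p 0 = K ∙ x₀ := by
    apply le_antisymm
    · intro x hx
      obtain ⟨c, rfl⟩ := hgen x hx
      exact Submodule.smul_mem _ c (Submodule.mem_span_singleton_self x₀)
    · rw [Submodule.span_le, Set.singleton_subset_iff]
      exact hx₀E
  rw [hE, finrank_span_singleton hx₀]

/-- The basis `x₀` of `E_0`. [folklore] -/
def basisZero {x₀ : W} (hx₀ : x₀ ≠ 0) (hx₀E : x₀ ∈ E σ ζ p 0) (hgen : ∀ x ∈ E σ ζ p 0, ∃ c : K, x = c • x₀) :
    Basis (Fin 1) K ↥(E σ ζ p 0) :=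
  FiniteDimensional.basisSingleton (Fin 1) (finrank_E_zero hx₀ hx₀E hgen) ⟨x₀, hx₀E⟩
    (fun h0 => hx₀ (by simpa using congrArg Subtype.val h0))

omit [CharZero K] [FiniteDimensional K W] in
/-- `basisZero _ = x₀`. [folklore] -/
theorem basisZero_apply {x₀ : W} (hx₀ : x₀ ≠ 0) (hx₀E : x₀ ∈ E σ ζ p 0)
    (hgen : ∀ x ∈ E σ ζ p 0, ∃ c : K, x = c • x₀) (a : Fin 1) :
    ((basisZero (σ := σ) (ζ := ζ) (p := p) hx₀ hx₀E hgen a : ↥(E σ ζ p 0)) : W) = x₀ := by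
  rw [basisZero, FiniteDimensional.basisSingleton_apply]

variable {n : ℕ} (hn : ∀ j, 1 ≤ j → j < p → Module.finrank K ↥(E σ ζ p j) = n)

/-- A basis `bE i` of the block `E_{i+1}` (`i < h`), indexed by `Fin n`. [folklore] -/
def bE (i : Fin h) : Basis (Fin n) K ↥(E σ ζ p (i.val + 1)) :=
  Module.finBasisOfFinrankEq K _ (hn (i.val + 1) (by omega) (by have := i.2; omega))

/-- **The basis `bD i` of `E_{p-(i+1)}` dual to `bE i` under `B`** (through the perfect pairing `E_{p-(i+1)} ≃ (E_{i+1})^∨`).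
[folklore] -/
def bD (i : Fin h) : Basis (Fin n) K ↥(E σ ζ p (p - (i.val + 1))) :=
  (bE hph hn i).dualBasis.map
    (eigenPairingEquiv hσ hζ hp hB hBn (k := i.val + 1) (l := p - (i.val + 1)) (by have := i.2; omega)
      (by omega) (by rw [Nat.add_sub_cancel' (by have := i.2; omega)])).symm

/-- **Duality**: `B (bE i a) (bD i a') = δ_{a a'}`. [folklore] -/
theorem apply_bE_bD (i : Fin h) (a a' : Fin n) :
    B (bE hph hn i a : W) (bD hσ hζ hp hph hB hBn hn i a' : W) = if a = a' then 1 else 0 := by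
  rw [bD, Basis.map_apply, ← eigenPairingEquiv_apply hσ hζ hp hB hBn (k := i.val + 1) (l := p - (i.val + 1))
    (by have := i.2; omega) (by omega) (by rw [Nat.add_sub_cancel' (by have := i.2; omega)]),
    LinearEquiv.apply_symm_apply, Basis.dualBasis_apply_self]

/-- Duality, transposed (`B` symmetric): `B (bD i a') (bE i a) = δ_{a a'}`. [folklore] -/
theorem apply_bD_bE (hBs : ∀ x y, B x y = B y x) (i : Fin h) (a a' : Fin n) :
    B (bD hσ hζ hp hph hB hBn hn i a' : W) (bE hph hn i a : W) = if a = a' then 1 else 0 := by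
  rw [hBs, apply_bE_bD]

/-! ### §3 The adapted basis -/

/-- The index type of the basis of a block: `Fin 1` for `E_0`, `Fin n` for the others. [folklore] -/
@[reducible] def blockFin (n : ℕ) : Option (Fin h × Bool) → Type
  | none => Fin 1
  | some _ => Fin n

/-- The chosen basis of each block. [folklore] -/
def blockBasis {x₀ : W} (hx₀ : x₀ ≠ 0) (hx₀E : x₀ ∈ E σ ζ p 0) (hgen : ∀ x ∈ E σ ζ p 0, ∃ c : K, x = c • x₀) :
    (o : Option (Fin h × Bool)) → Basis (blockFin (h := h) n o) K ↥(E σ ζ p (blockIdx p h o))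
  | none => basisZero hx₀ hx₀E hgen
  | some (i, false) => bE hph hn i
  | some (i, true) => bD hσ hζ hp hph hB hBn hn i

/-- The letters `Option (Fin h × Bool × Fin n)` versus the sigma type of the block bases. [folklore] -/
def letterEquiv (h n : ℕ) : Option (Fin h × Bool × Fin n) ≃ Σ o : Option (Fin h × Bool), blockFin (h := h) n o where
  toFun
    | none => ⟨none, (0 : Fin 1)⟩
    | some (i, b, a) => ⟨some (i, b), a⟩
  invFun
    | ⟨none, _⟩ => none
    | ⟨some (i, b), a⟩ => some (i, b, a)
  left_inv := by rintro (_ | ⟨i, b, a⟩) <;> rfl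
  right_inv := by
    rintro ⟨_ | ⟨i, b⟩, a⟩
    · have ha : a = (0 : Fin 1) := Subsingleton.elim _ _
      subst ha; rfl
    · rfl

/-- **The adapted basis of `W`**: `none ↦ x₀`, `(i, false, a) ↦ bE i a ∈ E_{i+1}`, `(i, true, a) ↦ bD i a ∈ E_{p-(i+1)}`.
[folklore] -/
def adaptedBasis {x₀ : W} (hx₀ : x₀ ≠ 0) (hx₀E : x₀ ∈ E σ ζ p 0) (hgen : ∀ x ∈ E σ ζ p 0, ∃ c : K, x = c • x₀) :
    Basis (Option (Fin h × Bool × Fin n)) K W :=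
  ((isInternal_block hσ hζ hp hph).collectedBasis (blockBasis hσ hζ hp hph hB hBn hn hx₀ hx₀E hgen)).reindex
    (letterEquiv h n).symm

variable {x₀ : W} (hx₀ : x₀ ≠ 0) (hx₀E : x₀ ∈ E σ ζ p 0) (hgen : ∀ x ∈ E σ ζ p 0, ∃ c : K, x = c • x₀)

/-- The adapted basis at `none` is `x₀`. [folklore] -/
theorem adaptedBasis_none : adaptedBasis hσ hζ hp hph hB hBn hn hx₀ hx₀E hgen none = x₀ := by
  rw [adaptedBasis, Basis.reindex_apply, Equiv.symm_symm, DirectSum.IsInternal.collectedBasis_coe]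
  exact basisZero_apply hx₀ hx₀E hgen 0

/-- The adapted basis on the vector letters of colour `i` is `bE i`. [folklore] -/
theorem adaptedBasis_vec (i : Fin h) (a : Fin n) :
    adaptedBasis hσ hζ hp hph hB hBn hn hx₀ hx₀E hgen (some (i, false, a)) = (bE hph hn i a : W) := by
  rw [adaptedBasis, Basis.reindex_apply, Equiv.symm_symm, DirectSum.IsInternal.collectedBasis_coe]
  rfl

/-- The adapted basis on the covector letters of colour `i` is `bD i`. [folklore] -/
theorem adaptedBasis_cov (i : Fin h) (a : Fin n) :
    adaptedBasis hσ hζ hp hph hB hBn hn hx₀ hx₀E hgen (some (i, true, a)) = (bD hσ hζ hp hph hB hBn hn i a : W) := by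
  rw [adaptedBasis, Basis.reindex_apply, Equiv.symm_symm, DirectSum.IsInternal.collectedBasis_coe]
  rfl

/-- The block of a letter. [folklore] -/
def letterBlock (p h n : ℕ) (l : Option (Fin h × Bool × Fin n)) : ℕ := blockIdx p h (l.map fun x => (x.1, x.2.1))

/-- The letter `none` (the vector `x₀`) has block `0`. [folklore] -/
@[simp] theorem letterBlock_none : letterBlock p h n none = 0 := rfl
/-- A vector letter of colour `i` has block `i + 1`. [folklore] -/
@[simp] theorem letterBlock_vec (i : Fin h) (a : Fin n) : letterBlock p h n (some (i, false, a)) = i.val + 1 := rfl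
/-- A covector letter of colour `i` has block `p - (i + 1)`. [folklore] -/
@[simp] theorem letterBlock_cov (i : Fin h) (a : Fin n) : letterBlock p h n (some (i, true, a)) = p - (i.val + 1) := rfl

/-- **Each adapted basis vector lies in its block.** [folklore] -/
theorem adaptedBasis_mem (l : Option (Fin h × Bool × Fin n)) :
    adaptedBasis hσ hζ hp hph hB hBn hn hx₀ hx₀E hgen l ∈ E σ ζ p (letterBlock p h n l) := by
  rcases l with _ | ⟨i, _ | _, a⟩
  · rw [adaptedBasis_none]; exact hx₀E
  · rw [adaptedBasis_vec]; exact (bE hph hn i a).2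
  · rw [adaptedBasis_cov]; exact (bD hσ hζ hp hph hB hBn hn i a).2

/-- `σ` acts on an adapted basis vector by `ζ ^ block`. [folklore] -/
theorem apply_adaptedBasis (l : Option (Fin h × Bool × Fin n)) :
    σ (adaptedBasis hσ hζ hp hph hB hBn hn hx₀ hx₀E hgen l) =
      (ζ ^ letterBlock p h n l) • adaptedBasis hσ hζ hp hph hB hBn hn hx₀ hx₀E hgen l :=
  apply_of_mem_E hσ hζ hp (adaptedBasis_mem hσ hζ hp hph hB hBn hn hx₀ hx₀E hgen l)

/-- The spectral projector `P_k` keeps the letters of block `k` and kills the others. [folklore] -/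
theorem specProj_adaptedBasis (k : ℕ) (hk : k < p) (l : Option (Fin h × Bool × Fin n)) :
    specProj σ ζ p k (adaptedBasis hσ hζ hp hph hB hBn hn hx₀ hx₀E hgen l) =
      if letterBlock p h n l = k then adaptedBasis hσ hζ hp hph hB hBn hn hx₀ hx₀E hgen l else 0 := by
  have hmem := (range_specProj hσ hζ hp _).le (adaptedBasis_mem hσ hζ hp hph hB hBn hn hx₀ hx₀E hgen l)
  split_ifs with hlk
  · rw [← hlk]; exact specProj_apply_of_mem_eigenspace hζ hp _ hmem
  · have hlt : letterBlock p h n l < p := blockIdx_lt hph _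
    exact specProj_apply_of_mem_eigenspace_of_ne hζ hp hk hlt (Ne.symm hlk) hmem

/-- **`B` vanishes on adapted basis vectors of non-complementary blocks.** [folklore] -/
theorem apply_adaptedBasis_eq_zero {l l' : Option (Fin h × Bool × Fin n)}
    (hll' : ¬ p ∣ letterBlock p h n l + letterBlock p h n l') :
    B (adaptedBasis hσ hζ hp hph hB hBn hn hx₀ hx₀E hgen l) (adaptedBasis hσ hζ hp hph hB hBn hn hx₀ hx₀E hgen l') = 0 :=
  apply_eq_zero_of_mem_E hσ hζ hp hB hll' (adaptedBasis_mem hσ hζ hp hph hB hBn hn hx₀ hx₀E hgen l)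
    (adaptedBasis_mem hσ hζ hp hph hB hBn hn hx₀ hx₀E hgen l')

/-- **The `B`-table on vector/covector letters of the same colour**: `B (e_{i,a}) (e^{i,a'}) = δ_{a a'}`. [folklore] -/
theorem apply_adaptedBasis_vec_cov (i : Fin h) (a a' : Fin n) :
    B (adaptedBasis hσ hζ hp hph hB hBn hn hx₀ hx₀E hgen (some (i, false, a)))
      (adaptedBasis hσ hζ hp hph hB hBn hn hx₀ hx₀E hgen (some (i, true, a'))) = if a = a' then 1 else 0 := by
  rw [adaptedBasis_vec, adaptedBasis_cov, apply_bE_bD]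

/-- `B (e^{i,a'}) (e_{i,a}) = δ_{a a'}` (`B` symmetric). [folklore] -/
theorem apply_adaptedBasis_cov_vec (hBs : ∀ x y, B x y = B y x) (i : Fin h) (a a' : Fin n) :
    B (adaptedBasis hσ hζ hp hph hB hBn hn hx₀ hx₀E hgen (some (i, true, a')))
      (adaptedBasis hσ hζ hp hph hB hBn hn hx₀ hx₀E hgen (some (i, false, a))) = if a = a' then 1 else 0 := by
  rw [adaptedBasis_vec, adaptedBasis_cov, apply_bD_bE hσ hζ hp hph hB hBn hn hBs]

include hσ hζ hp hB hBn hx₀ hx₀E hgen in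
omit [FiniteDimensional K W] in
/-- **`B (x₀, x₀) ≠ 0`**: the line `E_0` is orthogonal to all other blocks, so nondegeneracy forces it. [folklore] -/
theorem apply_x₀_x₀_ne_zero : B x₀ x₀ ≠ 0 := by
  classical
  intro h0
  apply hx₀
  refine hBn.1 x₀ fun y => ?_
  -- expand `y` along the blocks
  rw [← sum_specProj_apply (σ := σ) hζ hp y, map_sum]
  refine Finset.sum_eq_zero fun j hj => ?_
  have hj' := Finset.mem_range.mp hj
  by_cases hj0 : j = 0
  · subst hj0
    obtain ⟨c, hc⟩ := hgen _ (LinearMap.mem_range_self (specProj σ ζ p 0) y)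
    rw [hc, map_smul, smul_eq_mul, h0, mul_zero]
  · exact apply_eq_zero_of_mem_E hσ hζ hp hB (k := 0) (l := j)
      (fun hd => hj0 (Nat.eq_zero_of_dvd_of_lt (by simpa using hd) hj')) hx₀E (LinearMap.mem_range_self _ y)

end Bases

end Summit.HodgeConjecture.HodgeConjecture.Theorems.CyclicUnitaryPowersEigenDualBasis

end
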